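import Summits.HodgeConjecture.HodgeConjecture.Theorems.R90S4U2UnipotentTorusWord              -- ★ p862125 (this seat) (f₁) `apply_eq_one_of_unipotentU_trivial`
import Summits.HodgeConjecture.HodgeConjecture.Theorems.F0P3cU2PrincipalSeriesJacquetFiltration   -- ★ `u2PrincipalSeries_jacquetFiltration` (dim `r_B i(χ) = 2`, line `wχ`, quotient `χ`)
import Summits.HodgeConjecture.HodgeConjecture.Theorems.F0P3bU2NoCharacterEigenvector             -- ★ `exists_torusU_two_norm_lt_one` (`d(a, a⁻¹)`, `σ a = a`, `‖a‖ < 1`)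
import Summits.HodgeConjecture.HodgeConjecture.Theorems.F0P3cU2PrincipalSeriesOpenCellTorusChar   -- ★ `exists_skew_unit_localRing`
import Literature.NumberTheory.Automorphic.UnitaryGroupUnipotentLimitCompactOpen                  -- ★ `isLimitOfCompactOpen_cmBorelTriple_N`
import Literature.NumberTheory.Automorphic.JacquetModuleExactProofs                               -- ★ BZ `Representation.jacquetMap_injective`
import Literature.NumberTheory.Automorphic.IrreducibleClassesConstituents                         -- ★ `IrrClass.IsConstituentOf`, `nontrivial_of_isIrreducible`
import HarnessLib

/-!
# R90-TF · S4 «Ch. 13.1–2» — (ORBIT)∕(SWAP) support, part (f₂): NO `N`-TRIVIAL CONSTITUENT — at a non-split place, in Keys' case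
# «`χ₁|F^× = ω_{E∕F}`», no constituent of the principal series `i(χ) = i_{U(Φ₂)}((χ₁, χ₂))` of `U(Φ₂)(L⁺_v) ≅ U(1,1)` has trivial `N`-action

Cell `hodgecm-mathlib`, crux H413 (`stmt-HodgeConjecture-24833`, lane `--supports … --as helper`), route of record `HCCMUnconditional`
(no route verbs; count-neutral).  Programme R90-TF (brief `director/R90-BRIEF.v2.md` 1f40d54518340a35), section S4 = Rogawski Ch. 13.1–2
(base `R90-C131`); seat R90-C131-p01 (g0); census `R90/R90-C131-p01/g0/CENSUS-orbit.md` 62930f5ed58633f2, road (f), toward (SWAP) = B ED. 4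
`stub_R90_S4_U2_ldsSwap` :442 ([Rogawski1990, §11.1 p. 161]): with ★ (c) SLOT LEMMA, ★ (e) DEGENERATE ⇒ `N`-TRIVIAL, ★ (b) TRANSPORT and ★ STAB,
the outer similitude must SWAP the two constituents — else one of them is `ψ`-degenerate for every `ψ ≠ 1`, hence `N`-trivial (★ (e)), which THIS
FILE forbids.  THEOREMS ONLY (no `def`, no instance, no notation, no named fact, no `sorry`); ★-only imports.

DESIGN.  Everything about subquotients and Jacquet functoriality is proved GENERICALLY (§§1–4: any group, any parabolic triple, any
field of characteristic `0`), so that only character-value bookkeeping is done on the CM carrier `∏_{w ∣ v} L_w` (§6).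

THE STATEMENT (`not_unipotentU_trivial_of_isConstituentOf_cmPrincipalSeries_two`).  `L` CM, `v` a finite place of `L⁺` NON-SPLIT in `L`,
`χ₁ : (L ⊗ L⁺_v)^× → ℂ^×` and `χ₂ : E¹_v → ℂ^×` continuous with `χ₁|F^× = ω_{E∕F}` (★ `IsQuadraticCharExtension`: `χ₁` is trivial on a `σ`-fixed
unit iff it is a norm), `χ = (χ₁, χ₂)` (★ `torusCharPair … 0 χ₁ χ₂`), `i(χ) = cmPrincipalSeries L 2 v χ`.  If `r` is an irreducible smooth
representation of `G₂ = U(Φ₂)(L⁺_v)` whose class is a constituent of `i(χ)` (★ `IrrClass.IsConstituentOf`), then `r|_N ≠ 1`.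

PROOF (exponents; [Casselman1995, §6.3–6.4, Lemma 7.1.1 (a)]; [BernsteinZelevinskyASENS1977, Prop. 1.9 (a), §2]).  Take `a` `σ`-fixed with
`‖a‖ < 1` (★ `exists_torusU_two_norm_lt_one`) and `h = d(a², a⁻²) ∈ T₂`.  (1) `jacquetModule_sq_sub_eq_zero_two`: on the Jacquet module `r_B i(χ)`
(★ `u2PrincipalSeries_jacquetFiltration`) `h` acts — in the UNnormalised action `[f] ↦ [h·f]` — by `c = δ_B^{1∕2}(h) wχ(h) = ‖a‖` on the line `ℓ` and by
`δ_B^{1∕2}(h) χ(h) = ‖a‖` modulo `ℓ` (`χ(h) = χ₁(a²) = 1 = wχ(h)` since `a² = σ(a) a` is a norm; `δ_B^{1∕2}(h) = ‖a²‖^{1∕2} = ‖a‖`, ★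
`rootDeltaChar_cmBorel_torus_two`), so `(h − c)² = 0` on `r_B i(χ)` (generic §3).  (2) GENERIC §4: the identity passes to `r_B M₁ ↪ r_B i(χ)` (★ BZ
`jacquetMap_injective`, ★ `isLimitOfCompactOpen_cmBorelTriple_N`) and to the quotient `r_B (M₁ ⁄ M₂)` for the subquotient `M₁ ⁄ M₂ ≅ r`; if
`(M₁ ⁄ M₂)|_N = 1` its Jacquet module is ALL of `M₁ ⁄ M₂ ≠ 0`, so if moreover `h` acts trivially on `M₁ ⁄ M₂` then `(1 − c)² = 0`, `c = 1`.
(3) `r|_N = 1` gives `(M₁ ⁄ M₂)|_N = 1` (§2) and then `h = d(x∕x′, x′∕x)` with `x = a² δ₀`, `x′ = δ₀` skew (★ `exists_skew_unit_localRing`) acts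
TRIVIALLY (★ (f₁) `apply_eq_one_of_unipotentU_trivial`: `h ∈ ⟨N, w₀ N w₀⟩`, `w₀` of matrix `Φ₂` from ★ `u2LocalBruhatDecomposition`); so `‖a‖ = 1` —
contradiction.

HONEST LABEL: HC_CM is proved only modulo the 7 printed citations (2 remaining named inputs: hLiu418 = stmt-HodgeConjecture-24832,
h413 = stmt-HodgeConjecture-24833) until rung 0 closes; this file is local representation theory of `U(1,1)` and discharges none of them.  REL ≠ ★ ≠ BUILT.

## References
[Rogawski1990] J. D. Rogawski, *Automorphic Representations of Unitary Groups in Three Variables* (1990), §11.1 p. 161, §12.1 pp. 171–172, §12.2 p. 173 ·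
[Casselman1995] W. Casselman, *Introduction to the theory of admissible representations of p-adic reductive groups* (1995), §6.3–§6.4, Lemma 7.1.1 (a) ·
[BernsteinZelevinskyASENS1977] I. N. Bernstein, A. V. Zelevinsky, *Induced representations of reductive p-adic groups I*, Ann. Sci. ÉNS 10 (1977), Prop. 1.9 (a), §2.
-/

set_option autoImplicit false
-- the mandated namespace (brief §3.4) repeats the single-problem summit's segment (`HodgeConjecture.HodgeConjecture`)
set_option linter.dupNamespace false

noncomputable section

open NumberField IsDedekindDomain
open scoped MatrixGroups NNReal
open Literature.NumberTheory.Automorphic Literature.NumberTheory.Automorphic.UnitaryGroup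
open Summit.HodgeConjecture.HodgeConjecture.Cruxes.H413.F0P3cU2PrincipalSeriesJacquetFiltration
open Summit.HodgeConjecture.HodgeConjecture.Cruxes.H413.F0P3bU2NoCharacterEigenvector
open Summit.HodgeConjecture.HodgeConjecture.Cruxes.H413.F0P3cU2PrincipalSeriesOpenCellTorusChar

namespace Summit.HodgeConjecture.HodgeConjecture.R90.S4

/-! ## §1 Two generic transport lemmas for the operator identity `(A − c)² = 0` -/

section Operator

variable {k : Type*} [CommRing k] {V₁ V₂ : Type*} [AddCommGroup V₁] [Module k V₁] [AddCommGroup V₂] [Module k V₂]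

/-- `(A − c)² = 0` pulls back along an INJECTIVE map intertwining `A₁` with `A₂`. [folklore] -/
theorem sq_sub_eq_zero_of_injective (A₁ : V₁ →ₗ[k] V₁) (A₂ : V₂ →ₗ[k] V₂) (f : V₁ →ₗ[k] V₂) (hf : Function.Injective f)
    (hfA : ∀ y, f (A₁ y) = A₂ (f y)) (c : k) (h : ∀ z, A₂ (A₂ z - c • z) - c • (A₂ z - c • z) = 0) (y : V₁) :
    A₁ (A₁ y - c • y) - c • (A₁ y - c • y) = 0 := by
  apply hf
  rw [map_zero, map_sub, map_smul, hfA, map_sub, map_smul, hfA]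
  exact h (f y)

/-- `(A − c)² = 0` pushes forward along a SURJECTIVE map intertwining `A₁` with `A₂`. [folklore] -/
theorem sq_sub_eq_zero_of_surjective (A₁ : V₁ →ₗ[k] V₁) (A₂ : V₂ →ₗ[k] V₂) (f : V₁ →ₗ[k] V₂) (hf : Function.Surjective f)
    (hfA : ∀ y, f (A₁ y) = A₂ (f y)) (c : k) (h : ∀ y, A₁ (A₁ y - c • y) - c • (A₁ y - c • y) = 0) (z : V₂) :
    A₂ (A₂ z - c • z) - c • (A₂ z - c • z) = 0 := by
  obtain ⟨y, rfl⟩ := hf z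
  have := congrArg f (h y)
  rwa [map_zero, map_sub, map_smul, hfA, map_sub, map_smul, hfA] at this

end Operator

/-! ## §2 Generic: an equivalence transports «`g` acts trivially» -/

section EquivTrivial

variable {k G V W : Type*} [CommSemiring k] [Monoid G] [AddCommMonoid V] [Module k V] [AddCommMonoid W] [Module k W]
  {ρ : Representation k G V} {τ : Representation k G W}

/-- If `ρ ≅ τ` and `ρ g = 1` then `τ g = 1`. [folklore] -/
theorem apply_eq_one_of_equiv (e : ρ.Equiv τ) (g : G) (h : ρ g = 1) : τ g = 1 := by
  refine LinearMap.ext fun w => ?_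
  obtain ⟨v, rfl⟩ := EquivLike.surjective e w
  have key := Representation.IntertwiningMap.isIntertwining _ _ e.toIntertwiningMap g v
  rw [Representation.Equiv.coe_toIntertwiningMap, h, Module.End.one_apply] at key
  rw [Module.End.one_apply]
  exact key.symm

end EquivTrivial

/-! ## §3 Generic: the UNnormalised Jacquet action of `m` satisfies `(A − δ^{1∕2}(m))² = 0` when the normalised one is `1` on a line and modulo it -/

section Line

variable {G V : Type*} [Group G] [TopologicalSpace G] [IsTopologicalGroup G] (t : ParabolicTriple G) [LocallyCompactSpace ↥t.P]
  [AddCommGroup V] [Module ℂ V]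

/-- **`(A_m − c)² = 0` on `r_P π`, `c = δ_P^{1∕2}(m)`**, for the UNnormalised Jacquet action `A_m [v] = [π m v]`, as soon as the NORMALISED action of `m`
is a scalar `w = 1` on a submodule `ℓ` and a scalar `u = 1` modulo `ℓ` (`A_m = c · r_P^{norm}(m)`, ★ `jacquetModule_mk` ∕ `normalizedJacquet_mk`).  The scalars are
taken as units `w, u` with `w = 1`, `u = 1` so that the eigen-data of ★ `u2PrincipalSeries_jacquetFiltration` are consumed VERBATIM.
[cite: Casselman1995, Lemma 7.1.1 (a); §3.1] [cite: BernsteinZelevinskyASENS1977, §2.3] -/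
theorem jacquetModule_sq_sub_eq_zero_of_line (π : Representation ℂ G V) (ℓ : Submodule ℂ (t.restrict π).Coinvariants) (m : ↥t.M) (c : ℂ)
    (w u : ℂˣ) (hδ : ((rootDeltaChar t.P (Subgroup.inclusion t.M_le m) : ℂˣ) : ℂ) = c) (hw : w = 1) (hu : u = 1)
    (hℓ : ∀ x ∈ ℓ, π.normalizedJacquet t m x = (w : ℂ) • x) (hq : ∀ x, π.normalizedJacquet t m x - (u : ℂ) • x ∈ ℓ)
    (z : (t.restrict π).Coinvariants) :
    π.jacquetModule t m (π.jacquetModule t m z - c • z) - c • (π.jacquetModule t m z - c • z) = 0 := by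
  subst hw hu
  simp only [Units.val_one, one_smul] at hℓ hq
  -- the UNnormalised action is `c •` the normalised one
  have hAn : ∀ x, π.jacquetModule t m x = c • π.normalizedJacquet t m x := by
    intro x
    induction x using Representation.Coinvariants.induction_on with
    | h w =>
      rw [Representation.jacquetModule_mk, Representation.normalizedJacquet_mk, smul_smul, ← hδ, Units.val_inv_eq_inv_val,
        mul_inv_cancel₀ (Units.ne_zero _), one_smul]
  have hz : π.jacquetModule t m z - c • z ∈ ℓ := by
    rw [hAn, ← smul_sub]
    exact ℓ.smul_mem _ (hq z)
  rw [hAn (π.jacquetModule t m z - c • z), hℓ _ hz, sub_self]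

end Line

/-! ## §4 Generic: a Jacquet exponent of an `N`-trivial, `m`-trivial, non-zero subquotient is `1` -/

section Exponent

variable {k G V : Type*} [Field k] [CharZero k] [Group G] [TopologicalSpace G] [IsTopologicalGroup G] [AddCommGroup V] [Module k V]

/-- **THE EXPONENT ARGUMENT** ([Casselman1995, §6.4]; [BernsteinZelevinskyASENS1977, Prop. 1.9 (a)]).  Let `π` be a smooth representation of `G`,
`(P, M, N)` a parabolic triple with `N` a union of compact open subgroups, `m ∈ M`, and `c` a scalar with `(A_m − c)² = 0` on the Jacquet module
`r_P π` (`A_m [v] = [π m v]`).  If a subquotient `Q = M₁ ⁄ (M₂ ∩ M₁)` of `π` is non-zero, `N`-trivial and `m`-trivial, then `c = 1`: the identity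
passes to `r_P M₁ ↪ r_P π` (★ BZ `jacquetMap_injective`) and to `r_P Q` (a quotient of `r_P M₁`), where `A_m = 1` and `r_P Q = Q ≠ 0`.
[cite: Casselman1995, §6.4] [cite: BernsteinZelevinskyASENS1977, Prop. 1.9 (a)] -/
theorem jacquet_exponent_eq_one_of_trivial_subquotient (π : Representation k G V) (hπ : π.IsSmooth) (t : ParabolicTriple G)
    (hN : IsLimitOfCompactOpen ↥t.N) (m : ↥t.M) (c : k)
    (hA : ∀ z, π.jacquetModule t m (π.jacquetModule t m z - c • z) - c • (π.jacquetModule t m z - c • z) = 0)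
    (M₁ M₂ : Subrepresentation π) (hQ : Nontrivial (↥M₁.toSubmodule ⧸ M₂.toSubmodule.comap M₁.toSubmodule.subtype))
    (hQN : ∀ n ∈ t.N, (M₁.toRepresentation.quotient (M₂.toSubmodule.comap M₁.toSubmodule.subtype)
      fun g _ hx ↦ M₂.apply_mem_toSubmodule g hx) n = 1)
    (hQm : (M₁.toRepresentation.quotient (M₂.toSubmodule.comap M₁.toSubmodule.subtype)
      fun g _ hx ↦ M₂.apply_mem_toSubmodule g hx) (m : G) = 1) :
    c = 1 := by
  haveI := hQ
  -- (1) transport to `r_P M₁` (BZ injectivity)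
  let ι : M₁.toRepresentation.IntertwiningMap π :=
    { toLinearMap := M₁.toSubmodule.subtype, isIntertwining' := fun g => LinearMap.ext fun x => rfl }
  have hιinj : Function.Injective (Representation.jacquetMap t ι) :=
    Representation.jacquetMap_injective t hN hπ ι Subtype.val_injective
  have hAM := sq_sub_eq_zero_of_injective (M₁.toRepresentation.jacquetModule t m) _
    (Representation.jacquetMap t ι).toLinearMap hιinj
    (fun y => Representation.IntertwiningMap.isIntertwining _ _ (Representation.jacquetMap t ι) m y) _ hA
  -- (2) transport to `r_P Q` (surjectivity)
  let q : M₁.toRepresentation.IntertwiningMap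
      (M₁.toRepresentation.quotient (M₂.toSubmodule.comap M₁.toSubmodule.subtype) fun g _ hx ↦ M₂.apply_mem_toSubmodule g hx) :=
    { toLinearMap := (M₂.toSubmodule.comap M₁.toSubmodule.subtype).mkQ, isIntertwining' := fun g => LinearMap.ext fun x => rfl }
  have hqsurj : Function.Surjective (Representation.jacquetMap t q) := by
    intro z
    obtain ⟨w, rfl⟩ := Representation.Coinvariants.mk_surjective _ z
    obtain ⟨y, rfl⟩ := Submodule.Quotient.mk_surjective _ w
    exact ⟨Representation.Coinvariants.mk _ y, rfl⟩
  have hAQ := sq_sub_eq_zero_of_surjective (M₁.toRepresentation.jacquetModule t m)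
    ((M₁.toRepresentation.quotient (M₂.toSubmodule.comap M₁.toSubmodule.subtype)
      fun g _ hx ↦ M₂.apply_mem_toSubmodule g hx).jacquetModule t m)
    (Representation.jacquetMap t q).toLinearMap hqsurj
    (fun y => Representation.IntertwiningMap.isIntertwining _ _ (Representation.jacquetMap t q) m y) _ hAM
  -- (3) on `r_P Q` the element `m` acts trivially
  have hQid : ∀ z, (M₁.toRepresentation.quotient (M₂.toSubmodule.comap M₁.toSubmodule.subtype)
      fun g _ hx ↦ M₂.apply_mem_toSubmodule g hx).jacquetModule t m z = z := by
    intro z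
    induction z using Representation.Coinvariants.induction_on with
    | h w =>
      rw [Representation.jacquetModule_mk]
      exact congrArg (Representation.Coinvariants.mk _) (congrArg (fun φ => φ w) hQm)
  -- (4) `r_P Q = Q ≠ 0`
  have hker : Representation.Coinvariants.ker (t.restrict
      (M₁.toRepresentation.quotient (M₂.toSubmodule.comap M₁.toSubmodule.subtype) fun g _ hx ↦ M₂.apply_mem_toSubmodule g hx)) = ⊥ := by
    rw [Representation.Coinvariants.ker, Submodule.span_eq_bot]
    rintro _ ⟨⟨n, w⟩, rfl⟩
    have h1 := congrArg (fun φ => φ w) (hQN _ (Subgroup.mem_subgroupOf.1 n.2))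
    simp only [Module.End.one_apply] at h1
    exact sub_eq_zero.2 h1
  obtain ⟨w, hw⟩ := exists_ne (0 : ↥M₁.toSubmodule ⧸ M₂.toSubmodule.comap M₁.toSubmodule.subtype)
  have hz : Representation.Coinvariants.mk (t.restrict
      (M₁.toRepresentation.quotient (M₂.toSubmodule.comap M₁.toSubmodule.subtype) fun g _ hx ↦ M₂.apply_mem_toSubmodule g hx)) w ≠ 0 := by
    rw [Ne, Representation.Coinvariants.mk_eq_zero, hker, Submodule.mem_bot]
    exact hw
  -- `(1 − c)² [w] = 0`
  have key := hAQ (Representation.Coinvariants.mk _ w)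
  rw [hQid, hQid] at key
  have key' : ((1 - c) * (1 - c)) • Representation.Coinvariants.mk (t.restrict
      (M₁.toRepresentation.quotient (M₂.toSubmodule.comap M₁.toSubmodule.subtype) fun g _ hx ↦ M₂.apply_mem_toSubmodule g hx)) w = 0 := by
    rw [mul_smul, sub_smul, one_smul, sub_smul, one_smul]
    exact key
  rcases smul_eq_zero.1 key' with h0 | h0
  · have := mul_self_eq_zero.1 h0
    rw [sub_eq_zero] at this
    exact this.symm
  · exact absurd h0 hz

end Exponent

/-! ## §5 (f₁) for a form GIVEN as `Φ₂` by an equation (the shape of ★ `cmBorelTriple L 2 v`) -/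

section OfEq

variable {R : Type*} [CommRing R] (σ : R →+* R) {J : Matrix (Fin 2) (Fin 2) R} (hJ : J = (StdForm.antidiagonal 2).over R)
include hJ

/-- ★ (f₁) `apply_eq_one_of_unipotentU_trivial` with the form `J = Φ₂` given by an equation (`subst`). [cite: Rogawski1990, §1.10 p. 9] -/
theorem apply_eq_one_of_unipotentU_trivial_of_eq {k V : Type*} [CommRing k] [AddCommGroup V] [Module k V]
    (π : Representation k ↥(unitaryGroupOfForm σ J) V) (hN : ∀ n ∈ unipotentU σ J, π n = 1)
    (w₀ : ↥(unitaryGroupOfForm σ J)) (hw₀ : ((w₀ : GL (Fin 2) R) : Matrix (Fin 2) (Fin 2) R) = J)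
    (x x' : Rˣ) (hx : σ x = -x) (hx' : σ x' = -x') (g : ↥(unitaryGroupOfForm σ J))
    (hg : ((g : GL (Fin 2) R) : Matrix (Fin 2) (Fin 2) R) = Matrix.diagonal ![((x * x'⁻¹ : Rˣ) : R), ((x' * x⁻¹ : Rˣ) : R)]) :
    π g = 1 := by
  subst hJ
  exact apply_eq_one_of_unipotentU_trivial σ π hN w₀ hw₀ x x' hx hx' g hg

end OfEq

/-! ## §6 The CM instance: `U(Φ₂)(L⁺_v)`, `v` non-split, Keys' case `χ₁|F^× = ω` -/

section Main

variable (L : Type) [Field L] [NumberField L] [IsCMField L]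

set_option synthInstance.maxHeartbeats 400000 in  -- instance paths on the CM carrier `∏_{w ∣ v} L_w` (as ★ `no_char_eigenvector_cmPrincipalSeries_two`)
set_option maxHeartbeats 4000000 in  -- character-value rewrites on the CM carrier (no Jacquet-module calculus here: that is generic §3)
/-- **`(h − ‖a‖)² = 0` on the Jacquet module `r_B i(χ)`** for `h = t₀²`, `t₀ = d(a, a⁻¹)`, `σ a = a`, in Keys' case `χ₁|F^× = ω`: in the UNnormalised
Jacquet action `h` acts by `δ^{1∕2}(h) wχ(h) = ‖a‖` on the line of ★ `u2PrincipalSeries_jacquetFiltration` and by `δ^{1∕2}(h) χ(h) = ‖a‖` modulo it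
(`χ₁(a²) = 1` as `a² = σ(a) a` is a norm); generic §3. [cite: Casselman1995, Lemma 7.1.1 (a)] [cite: Rogawski1990, §12.2 p. 173] -/
theorem jacquetModule_sq_sub_eq_zero_two (v : HeightOneSpectrum (𝓞 ↥(maximalRealSubfield L)))
    (hns : ∀ w : PlacesOver L v, IsCMField.complexConj L • w.1 = w.1)
    (χ₁ : (LocalRing L v)ˣ →* ℂˣ) (χ₂ : ↥(normOneUnits (conjLocal L (IsCMField.complexConj L) v)) →* ℂˣ)
    (h₁ : Continuous fun x => ((χ₁ x : ℂˣ) : ℂ)) (h₂ : Continuous fun x => ((χ₂ x : ℂˣ) : ℂ))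
    (hq : IsQuadraticCharExtension (conjLocal L (IsCMField.complexConj L) v) χ₁)
    (t₀ : ↥(torusU (conjLocal L (IsCMField.complexConj L) v) (cmLocalForm L 2 v))) (d : Fin 2 → (LocalRing L v)ˣ)
    (hd : glDiagonal 2 (LocalRing L v) d =
      ((t₀ : ↥(unitaryGroupOfForm (conjLocal L (IsCMField.complexConj L) v) (cmLocalForm L 2 v))) : GL (Fin 2) (LocalRing L v)))
    (hσa : conjLocal L (IsCMField.complexConj L) v (d 0 : LocalRing L v) = d 0) (hdet : d 0 * d 1 = 1) :
    haveI := locallyCompactSpace_cmBorelU L 2 v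
    ∀ z : ((cmBorelTriple L 2 v).restrict (cmPrincipalSeries L 2 v
        (torusCharPair (conjLocal L (IsCMField.complexConj L) v) (cmLocalForm L 2 v) (cmLocalForm_eq_over L 2 v) 0 χ₁ χ₂))).Coinvariants,
      (cmPrincipalSeries L 2 v (torusCharPair (conjLocal L (IsCMField.complexConj L) v) (cmLocalForm L 2 v) (cmLocalForm_eq_over L 2 v) 0 χ₁ χ₂)).jacquetModule
          (cmBorelTriple L 2 v) (t₀ * t₀)
        ((cmPrincipalSeries L 2 v (torusCharPair (conjLocal L (IsCMField.complexConj L) v) (cmLocalForm L 2 v) (cmLocalForm_eq_over L 2 v) 0 χ₁ χ₂)).jacquetModule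
            (cmBorelTriple L 2 v) (t₀ * t₀) z -
          ((((unitModulusChar (LocalRing L v) (d 0) : ℝ≥0) : ℝ) : ℂ)) • z) -
        ((((unitModulusChar (LocalRing L v) (d 0) : ℝ≥0) : ℝ) : ℂ)) •
          ((cmPrincipalSeries L 2 v (torusCharPair (conjLocal L (IsCMField.complexConj L) v) (cmLocalForm L 2 v) (cmLocalForm_eq_over L 2 v) 0 χ₁ χ₂)).jacquetModule
              (cmBorelTriple L 2 v) (t₀ * t₀) z -
            ((((unitModulusChar (LocalRing L v) (d 0) : ℝ≥0) : ℝ) : ℂ)) • z) = 0 := by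
  haveI := locallyCompactSpace_cmBorelU L 2 v
  intro z
  -- the exponent data (destructure a HYPOTHESIS, never the term: `rcases` on a term `generalize`s over the whole CM-carrier goal)
  have HF := u2PrincipalSeries_jacquetFiltration L v hns χ₁ χ₂ h₁ h₂
  obtain ⟨_, _, ℓ, _, hℓ, hquot⟩ := HF
  -- character values at `h = t₀²`
  have hentry₀ : torusEntry (conjLocal L (IsCMField.complexConj L) v) (cmLocalForm L 2 v) 0 t₀ = d 0 :=
    torusEntry_eq_of_glDiagonal_eq _ _ 0 t₀ d hd
  have hentry : torusEntry (conjLocal L (IsCMField.complexConj L) v) (cmLocalForm L 2 v) 0 (t₀ * t₀) = d 0 * d 0 := by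
    rw [map_mul (torusEntry (conjLocal L (IsCMField.complexConj L) v) (cmLocalForm L 2 v) 0) t₀ t₀, hentry₀]
  have hfix : conjLocal L (IsCMField.complexConj L) v ((d 0 * d 0 : (LocalRing L v)ˣ) : LocalRing L v) = (d 0 * d 0 : (LocalRing L v)ˣ) := by
    rw [Units.val_mul, map_mul (conjLocal L (IsCMField.complexConj L) v) (d 0 : LocalRing L v) (d 0 : LocalRing L v), hσa]
  have hnorm : χ₁ (d 0 * d 0) = 1 := (hq (d 0 * d 0) hfix).2 ⟨d 0, by rw [Units.val_mul, hσa]⟩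
  have hmapσ : Units.map (conjLocal L (IsCMField.complexConj L) v : LocalRing L v →* LocalRing L v) (d 0 * d 0) = d 0 * d 0 :=
    Units.ext (by rw [Units.coe_map, MonoidHom.coe_coe, hfix])
  have htorusDet₀ : torusDetNormOne (conjLocal L (IsCMField.complexConj L) v) (cmLocalForm L 2 v) (cmLocalForm_eq_over L 2 v) t₀ = 1 := by
    refine Subtype.ext ?_
    rw [coe_torusDetNormOne, torusDet_eq_of_glDiagonal_eq _ _ t₀ d hd, Fin.prod_univ_two, hdet]
    rfl
  have htorusDet : torusDetNormOne (conjLocal L (IsCMField.complexConj L) v) (cmLocalForm L 2 v) (cmLocalForm_eq_over L 2 v) (t₀ * t₀) = 1 := by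
    rw [map_mul (torusDetNormOne (conjLocal L (IsCMField.complexConj L) v) (cmLocalForm L 2 v) (cmLocalForm_eq_over L 2 v)) t₀ t₀, htorusDet₀, mul_one]
  have hχh : torusCharPair (conjLocal L (IsCMField.complexConj L) v) (cmLocalForm L 2 v) (cmLocalForm_eq_over L 2 v) 0 χ₁ χ₂ (t₀ * t₀) = 1 := by
    rw [torusCharPair_apply, hentry, hnorm, htorusDet, map_one χ₂, mul_one]
  have hwχh : weylTorusCharPair (conjLocal L (IsCMField.complexConj L) v) (cmLocalForm L 2 v) (cmLocalForm_eq_over L 2 v) 0 χ₁ χ₂ (t₀ * t₀) = 1 := by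
    rw [weylTorusCharPair_apply, hentry, htorusDet, map_one χ₂, mul_one, hmapσ, hnorm, inv_one]
  -- `δ^{1/2}(h) = ‖a‖`
  have hu : unitModulusChar (LocalRing L v) (d 0 * d 0) = unitModulusChar (LocalRing L v) (d 0) * unitModulusChar (LocalRing L v) (d 0) :=
    map_mul _ _ _
  have hδ : ((rootDeltaChar (cmBorelTriple L 2 v).P (Subgroup.inclusion (cmBorelTriple L 2 v).M_le (t₀ * t₀)) : ℂˣ) : ℂ) =
      (((unitModulusChar (LocalRing L v) (d 0) : ℝ≥0) : ℝ) : ℂ) := by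
    have hincl : Subgroup.inclusion (cmBorelTriple L 2 v).M_le (t₀ * t₀) =
        ⟨((t₀ * t₀ : ↥(torusU (conjLocal L (IsCMField.complexConj L) v) (cmLocalForm L 2 v))) :
          ↥(unitaryGroupOfForm (conjLocal L (IsCMField.complexConj L) v) (cmLocalForm L 2 v))), torusU_le_borelU _ _ (t₀ * t₀).2⟩ := rfl
    rw [hincl, rootDeltaChar_cmBorel_torus_two L v (t₀ * t₀), hentry, coe_halfModulusChar_apply, hu, NNReal.sqrt_mul_self]
  -- generic §3
  exact jacquetModule_sq_sub_eq_zero_of_line (cmBorelTriple L 2 v) _ ℓ (t₀ * t₀) _ _ _ hδ hwχh hχh (hℓ (t₀ * t₀)) (hquot (t₀ * t₀)) z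

set_option synthInstance.maxHeartbeats 400000 in  -- instance paths on the CM carrier `∏_{w ∣ v} L_w`
set_option maxHeartbeats 4000000 in  -- matrix bookkeeping on the CM carrier (no Jacquet-module calculus here: that is generic §4)
/-- **NO `N`-TRIVIAL CONSTITUENT OF `i(χ)` IN KEYS' CASE `χ₁|F^× = ω_{E∕F}`** (non-split `v`): an irreducible smooth representation `r` of
`U(Φ₂)(L⁺_v)` whose class is a constituent of `i(χ) = cmPrincipalSeries L 2 v (χ₁, χ₂)` (`χ₁, χ₂` continuous, `χ₁` trivial exactly on the norms among
the `σ`-fixed units) is NOT trivial on the unipotent radical `N` of the Borel subgroup.  See the module docstring for the proof.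
[cite: Casselman1995, §6.4, Lemma 7.1.1 (a)] [cite: Rogawski1990, §11.1 p. 161; §12.1 pp. 171–172] [cite: BernsteinZelevinskyASENS1977, Prop. 1.9 (a)] -/
theorem not_unipotentU_trivial_of_isConstituentOf_cmPrincipalSeries_two (v : HeightOneSpectrum (𝓞 ↥(maximalRealSubfield L)))
    (hns : ∀ w : PlacesOver L v, IsCMField.complexConj L • w.1 = w.1)
    (χ₁ : (LocalRing L v)ˣ →* ℂˣ) (χ₂ : ↥(normOneUnits (conjLocal L (IsCMField.complexConj L) v)) →* ℂˣ)
    (h₁ : Continuous fun x => ((χ₁ x : ℂˣ) : ℂ)) (h₂ : Continuous fun x => ((χ₂ x : ℂˣ) : ℂ))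
    (hq : IsQuadraticCharExtension (conjLocal L (IsCMField.complexConj L) v) χ₁)
    (r : SmoothIrrep ↥(unitaryGroupOfForm (conjLocal L (IsCMField.complexConj L) v) (cmLocalForm L 2 v)))
    (hc : (IrrClass.mk r).IsConstituentOf (cmPrincipalSeries L 2 v
      (torusCharPair (conjLocal L (IsCMField.complexConj L) v) (cmLocalForm L 2 v) (cmLocalForm_eq_over L 2 v) 0 χ₁ χ₂)))
    (hN : ∀ n ∈ (cmBorelTriple L 2 v).N, r.ρ n = 1) : False := by
  haveI := locallyCompactSpace_cmBorelU L 2 v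
  -- (0) the subquotient `Q = M₁ ⁄ M₂ ≅ r`; `Q|_N = 1`, `Q ≠ 0`
  obtain ⟨s, hs, M₁, M₂, -, ⟨e⟩⟩ := hc
  obtain ⟨f⟩ := (IrrClass.mk_eq_mk_iff s r).1 hs
  have e' := f.symm.trans e
  have hQN : ∀ n ∈ (cmBorelTriple L 2 v).N,
      (M₁.toRepresentation.quotient (M₂.toSubmodule.comap M₁.toSubmodule.subtype) fun g _ hx ↦ M₂.apply_mem_toSubmodule g hx) n = 1 :=
    fun n hn => apply_eq_one_of_equiv e' n (hN n hn)
  have hQ : Nontrivial (↥M₁.toSubmodule ⧸ M₂.toSubmodule.comap M₁.toSubmodule.subtype) := by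
    haveI := e'.isIrreducible
    exact IrrClass.nontrivial_of_isIrreducible
      (M₁.toRepresentation.quotient (M₂.toSubmodule.comap M₁.toSubmodule.subtype) fun g _ hx ↦ M₂.apply_mem_toSubmodule g hx)
  -- (1) the torus element `h = t₀²`, `t₀ = d(a, a⁻¹)`, `σ a = a`, `‖a‖ < 1`; a skew unit `δ₀`; `w₀`
  obtain ⟨t₀, d, hd, hσa, hlt, hdet⟩ := exists_torusU_two_norm_lt_one L v
  have hd1 : d 1 = (d 0)⁻¹ := eq_inv_of_mul_eq_one_right hdet
  obtain ⟨δ₀, hδ₀⟩ := exists_skew_unit_localRing L v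
  obtain ⟨w₀, hw₀, -, -, -⟩ := u2LocalBruhatDecomposition L v hns
  have e1 : (d 0 * d 0 * δ₀) * δ₀⁻¹ = d 0 * d 0 := mul_inv_cancel_right _ _
  have e2 : δ₀ * (d 0 * d 0 * δ₀)⁻¹ = (d 0)⁻¹ * (d 0)⁻¹ := by
    rw [mul_inv_rev, mul_inv_rev, mul_inv_cancel_left]
  have hGL : (((t₀ * t₀ : ↥(torusU (conjLocal L (IsCMField.complexConj L) v) (cmLocalForm L 2 v))) :
      ↥(unitaryGroupOfForm (conjLocal L (IsCMField.complexConj L) v) (cmLocalForm L 2 v))) : GL (Fin 2) (LocalRing L v)) =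
      glDiagonal 2 (LocalRing L v) (d * d) := by
    rw [map_mul, hd]
    rfl
  have hmat : ((((t₀ * t₀ : ↥(torusU (conjLocal L (IsCMField.complexConj L) v) (cmLocalForm L 2 v))) :
      ↥(unitaryGroupOfForm (conjLocal L (IsCMField.complexConj L) v) (cmLocalForm L 2 v))) : GL (Fin 2) (LocalRing L v)) :
        Matrix (Fin 2) (Fin 2) (LocalRing L v)) =
      Matrix.diagonal ![(((d 0 * d 0 * δ₀) * δ₀⁻¹ : (LocalRing L v)ˣ) : LocalRing L v), ((δ₀ * (d 0 * d 0 * δ₀)⁻¹ : (LocalRing L v)ˣ) : LocalRing L v)] := by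
    rw [e1, e2, hGL, coe_glDiagonal]
    congr 1
    funext i
    fin_cases i
    · simp
    · simp [hd1]
  have hQh : (M₁.toRepresentation.quotient (M₂.toSubmodule.comap M₁.toSubmodule.subtype) fun g _ hx ↦ M₂.apply_mem_toSubmodule g hx)
      ((t₀ * t₀ : ↥(torusU (conjLocal L (IsCMField.complexConj L) v) (cmLocalForm L 2 v))) :
        ↥(unitaryGroupOfForm (conjLocal L (IsCMField.complexConj L) v) (cmLocalForm L 2 v))) = 1 :=
    apply_eq_one_of_unipotentU_trivial_of_eq (conjLocal L (IsCMField.complexConj L) v) (cmLocalForm_eq_over L 2 v) _ hQN w₀ hw₀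
      (d 0 * d 0 * δ₀) δ₀ (by rw [Units.val_mul, Units.val_mul, map_mul, map_mul, hδ₀, hσa]; ring) hδ₀ _ hmat
  -- (2) `(h − c)² = 0` on `r_B i(χ)`, `c = ‖a‖`
  have hA := jacquetModule_sq_sub_eq_zero_two L v hns χ₁ χ₂ h₁ h₂ hq t₀ d hd hσa hdet
  have hIsm : (cmPrincipalSeries L 2 v (torusCharPair (conjLocal L (IsCMField.complexConj L) v) (cmLocalForm L 2 v) (cmLocalForm_eq_over L 2 v) 0 χ₁ χ₂)).IsSmooth := by
    unfold cmPrincipalSeries principalSeries Representation.normalizedInd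
    exact Representation.isSmooth_smoothInd (cmBorelTriple L 2 v).P _
  -- (3) generic §4: `c = 1`; but `c = ‖a‖ < 1`
  have hc := jacquet_exponent_eq_one_of_trivial_subquotient _ hIsm (cmBorelTriple L 2 v) (isLimitOfCompactOpen_cmBorelTriple_N L 2 v)
    (t₀ * t₀) _ hA M₁ M₂ hQ hQN hQh
  have hc' : ((unitModulusChar (LocalRing L v) (d 0) : ℝ≥0) : ℝ) = 1 := by exact_mod_cast hc
  have hlt' : ((unitModulusChar (LocalRing L v) (d 0) : ℝ≥0) : ℝ) < 1 := by exact_mod_cast hlt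
  exact absurd hc' (ne_of_lt hlt')

end Main

end Summit.HodgeConjecture.HodgeConjecture.R90.S4

end
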